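import Mathlib
import Summits.RiemannHypothesis.RiemannHypothesis.Theorems.PfPersistenceAdmissibleClass
import Summits.RiemannHypothesis.RiemannHypothesis.Theorems.PfPersistenceF2PlantedEnvelope

/-!
# PfPersistenceF2RobustBelow — resolution-bounded robustness and the planted twin (adj-3 RULING A29(d))

pub-rhpf-fake-2 gen 3 (mechanism/rigidity campaign; **no RH claims**), FAKES.md §2, ADJ-LOG A29(a–d).

The planted family (FAKES §2.0): ζ's explicit-formula side with a zero quadruple `{½ ± η ± iγ}` of
multiplicity `w` planted on the spectral side changes the even Galerkin block at window `(a, N)` from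
`Q_ζ` to `Q_ζ + c (p pᵀ − q qᵀ)`, `c = 4w`, `p + iq = (u_n(η + iγ))_{n ≤ N}`,
`u_n(z) = ∫_{-a}^{a} ξ_n(x) e^{zx} dx` (a real pair `{½ ± η}`, `γ = 0`, gives `q = 0` and `c = 2w`).
Here this datum is DEFINED (`plantedDatum`, the `u_n` by their integral meaning over the tree's basis
`xiEven`) and adj-3's closer is typed and proved at kernel level:

* `UniformlyCloseOn W ε d d'` / `RobustOn W ε S d₀` — quadratic-form closeness on a WINDOW SET `W` and
  "membership of `S` cannot tell `d₀` from anything `ε`-close to it on `W`"; adj-3's literal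
  `RobustBelow N₀ ε S d₀` is the case `W = rankBelow N₀ = {win | win.N ≤ N₀}` (`robustBelow_iff_robustOn`).
  HONEST CORRECTION recorded here: the planted envelope is NOT uniform in `a` at fixed `N₀`
  (`|u_n(η+iγ)|² ~ e^{2ηa}/(aγ²)` as `a → ∞`), so the window set that the DATA supports is the SERVED box
  `served A₀ N₀ = {win | win.a ≤ A₀ ∧ win.N ≤ N₀}`, not `rankBelow N₀`; every theorem is stated for an
  arbitrary `W` and specialises to both.
* `plantedDatum_uniformlyCloseOn` : the envelope hypothesis `PlantedEnvelopeOn W B c η γ`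
  (`c (‖p_win‖² + ‖q_win‖²) ≤ B` on `W`; analytic half THEOREM-informal/DATA, FAKES §2.1) gives
  `UniformlyCloseOn W B (plantedDatum c η γ) zetaDatum` (from the landed algebraic half
  `abs_dotProduct_planted_mulVec_le`).
* `robustOn_accepts_planted` / `robustBelow_accepts_planted` (adj-3's kernel target):
  `RobustOn W B S zetaDatum → zetaDatum ∈ S → plantedDatum c η γ ∈ S`;
  `not_separates_planted` : with `DetectablyNegative (plantedDatum c η γ)` (Arb certificates, A29(b))
  `¬ Separates S D zetaDatum` for every `D ∋ plantedDatum c η γ` — what CLOSES CANDIDATES (A29(d)(iii)).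
* `rejects_planted_not_robustOn` : the contrapositive = the offered GAP-CLASS reading (A29(d)(v)): a
  criterion that accepts ζ and rejects the twin reads `W` at resolution finer than `B` (or reads outside `W`).
* `robustOn_floorCriterion_of_margin` : a model inhabitant — floor criteria read with a margin are
  `RobustOn` — so the notion is not vacuous.

All proofs are elementary (modus ponens, Cauchy–Schwarz via the landed envelope lemma). [folklore]
-/

namespace Summit.RiemannHypothesis.RiemannHypothesis.Theorems.PfPersistenceF2RobustBelow

open Matrix BigOperators
open Summit.RiemannHypothesis.RiemannHypothesis.Theorems.PfPersistence
open Summit.RiemannHypothesis.RiemannHypothesis.Theorems.PfPersistenceF2PlantedEnvelope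
  (abs_dotProduct_planted_mulVec_le)

/-! ## §1 Closeness and robustness on a window set -/

/-- Quadratic-form closeness `|vᵀ (d_w − d'_w) v| ≤ ε |v|²` at every window of the set `W`
(the tree's `UniformlyClose` is the case `W = univ`). [folklore] -/
def UniformlyCloseOn (W : Set Window) (ε : ℝ) (d d' : Datum) : Prop :=
  ∀ win ∈ W, ∀ v : Fin (win.N + 1) → ℝ, |v ⬝ᵥ ((d win - d' win) *ᵥ v)| ≤ ε * (v ⬝ᵥ v)

/-- ROBUST ON `W` AT RESOLUTION `ε`: membership of `S` does not separate `d₀` from any datum `ε`-close to it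
on the windows of `W` ("`S` reads only `W`, at resolution coarser than `ε`, near `d₀`"). [folklore] -/
def RobustOn (W : Set Window) (ε : ℝ) (S : Set Datum) (d₀ : Datum) : Prop :=
  ∀ d : Datum, UniformlyCloseOn W ε d d₀ → (d₀ ∈ S ↔ d ∈ S)

/-- the windows of truncation rank at most `N₀` (adj-3's "below"). [folklore] -/
def rankBelow (N₀ : ℕ) : Set Window := {win | win.N ≤ N₀}

/-- the SERVED box: half-length at most `A₀` and rank at most `N₀` (what the dataset actually covers). [folklore] -/
def served (A₀ : ℝ) (N₀ : ℕ) : Set Window := {win | win.a ≤ A₀ ∧ win.N ≤ N₀}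

/-- the served box lies below its rank bound. -/
theorem served_subset_rankBelow (A₀ : ℝ) (N₀ : ℕ) : served A₀ N₀ ⊆ rankBelow N₀ :=
  fun _ h => h.2

/-- adj-3 RULING A29(d)(iii), verbatim: the `N`-bounded sibling of `UniformlyRobustAt`. [folklore] -/
def RobustBelow (N₀ : ℕ) (ε : ℝ) (S : Set Datum) (d₀ : Datum) : Prop :=
  ∀ d : Datum, (∀ win : Window, win.N ≤ N₀ → ∀ v : Fin (win.N + 1) → ℝ,
    |v ⬝ᵥ ((d win - d₀ win) *ᵥ v)| ≤ ε * (v ⬝ᵥ v)) → (d₀ ∈ S ↔ d ∈ S)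

/-- adj-3's `RobustBelow N₀` is `RobustOn (rankBelow N₀)` (definitionally). -/
theorem robustBelow_iff_robustOn (N₀ : ℕ) (ε : ℝ) (S : Set Datum) (d₀ : Datum) :
    RobustBelow N₀ ε S d₀ ↔ RobustOn (rankBelow N₀) ε S d₀ := Iff.rfl

/-- `0 ≤ v·v`. -/
private theorem dot_self_nonneg {k : ℕ} (v : Fin k → ℝ) : 0 ≤ v ⬝ᵥ v := by
  have : v ⬝ᵥ v = ∑ i, v i ^ 2 := by simp [dotProduct, pow_two]
  rw [this]; exact Finset.sum_nonneg fun i _ => sq_nonneg _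

/-- the tree's all-windows closeness restricts to any window set. -/
theorem uniformlyCloseOn_of_uniformlyClose {ε : ℝ} {d d' : Datum} (h : UniformlyClose ε d d')
    (W : Set Window) : UniformlyCloseOn W ε d d' :=
  fun win _ v => h win v

/-- closeness on `W` is symmetric. -/
theorem UniformlyCloseOn.symm {W : Set Window} {ε : ℝ} {d d' : Datum} (h : UniformlyCloseOn W ε d d') :
    UniformlyCloseOn W ε d' d := by
  intro win hwin v
  have h1 := h win hwin v
  have h2 : v ⬝ᵥ ((d' win - d win) *ᵥ v) = -(v ⬝ᵥ ((d win - d' win) *ᵥ v)) := by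
    rw [← neg_sub (d win) (d' win), Matrix.neg_mulVec, dotProduct_neg]
  rw [h2, abs_neg]; exact h1

/-- closeness on `W` at `ε` gives closeness on any `W' ⊆ W` at any `ε' ≥ ε`. -/
theorem UniformlyCloseOn.mono {W W' : Set Window} {ε ε' : ℝ} {d d' : Datum} (h : UniformlyCloseOn W ε d d')
    (hW : W' ⊆ W) (hε : ε ≤ ε') : UniformlyCloseOn W' ε' d d' := by
  intro win hwin v
  have h1 := h win (hW hwin) v
  have h2 := dot_self_nonneg v
  nlinarith

/-- enlarging the window set or refining the resolution preserves robustness. -/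
theorem RobustOn.mono {W W' : Set Window} {ε ε' : ℝ} {S : Set Datum} {d₀ : Datum} (h : RobustOn W ε S d₀)
    (hW : W ⊆ W') (hε : ε' ≤ ε) : RobustOn W' ε' S d₀ :=
  fun d hd => h d (hd.mono hW hε)

/-- modus ponens: a robust criterion that accepts `d₀` accepts everything close to it on `W`. -/
theorem RobustOn.accepts {W : Set Window} {ε : ℝ} {S : Set Datum} {d₀ d : Datum} (h : RobustOn W ε S d₀)
    (hd : UniformlyCloseOn W ε d d₀) (h₀ : d₀ ∈ S) : d ∈ S :=
  (h d hd).mp h₀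

/-- … hence it separates no set containing a detectably negative datum close to `d₀` on `W`. -/
theorem RobustOn.not_separates {W : Set Window} {ε : ℝ} {S D : Set Datum} {d₀ d : Datum}
    (h : RobustOn W ε S d₀) (hdD : d ∈ D) (hneg : DetectablyNegative d) (hd : UniformlyCloseOn W ε d d₀) :
    ¬ Separates S D d₀ :=
  fun hsep => hsep.2 d hdD hneg (h.accepts hd hsep.1)

/-- contrapositive (the GAP-CLASS reading, A29(d)(v)): a criterion accepting `d₀` and rejecting a datum that is
`ε`-close on `W` is NOT robust on `W` at resolution `ε` — it reads `W` finer than `ε`, or reads outside `W`. -/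
theorem not_robustOn_of_rejects {W : Set Window} {ε : ℝ} {S : Set Datum} {d₀ d : Datum} (h₀ : d₀ ∈ S)
    (hd : d ∉ S) (hclose : UniformlyCloseOn W ε d d₀) : ¬ RobustOn W ε S d₀ :=
  fun h => hd (h.accepts hclose h₀)

/-! ## §2 A model inhabitant: floor criteria read with a margin -/

/-- "the Rayleigh floor of `d` at every window of `W` is at least `t win`" (an `ε₁`-type criterion on `W`). [folklore] -/
def floorCriterionOn (W : Set Window) (t : Window → ℝ) : Set Datum :=
  {d | ∀ win ∈ W, ∀ v : Fin (win.N + 1) → ℝ, t win * (v ⬝ᵥ v) ≤ v ⬝ᵥ (d win *ᵥ v)}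

/-- PROVED: if `d₀` passes the floor with margin `ε ≥ 0`, the floor criterion is robust on `W` at resolution `ε`
near `d₀` (Weyl). So `RobustOn` is inhabited by genuine `ε₁` criteria; it is the MARGIN that makes them robust. -/
theorem robustOn_floorCriterion_of_margin {W : Set Window} {t : Window → ℝ} {ε : ℝ} {d₀ : Datum} (hε : 0 ≤ ε)
    (h₀ : d₀ ∈ floorCriterionOn W (fun win => t win + ε)) : RobustOn W ε (floorCriterionOn W t) d₀ := by
  intro d hd
  constructor
  · intro _ win hwin v
    have h1 := h₀ win hwin v
    have h2 := hd win hwin v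
    have h3 : v ⬝ᵥ ((d win - d₀ win) *ᵥ v) = v ⬝ᵥ (d win *ᵥ v) - v ⬝ᵥ (d₀ win *ᵥ v) := by
      rw [Matrix.sub_mulVec, dotProduct_sub]
    rw [h3] at h2
    have h4 := (abs_le.mp h2).1
    simp only at h1
    nlinarith
  · intro _ win hwin v
    have h1 := h₀ win hwin v
    have h2 := dot_self_nonneg v
    simp only at h1
    nlinarith

/-! ## §3 The planted datum and adj-3's closer -/

/-- `u_n(z) = ∫_{-a}^{a} ξ_n(x) e^{zx} dx`, `z = η + iγ`: the window transform of the basis vector `ξ_n` at the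
planted zero offset (closed form `√(2/L)·2z sinh(zL/2)/(z² + ω_n²)`, `ω_n = 2πn/L`, `L = 2a`; `u_0 = 2 sinh(zL/2)/(z√L)`). [folklore] -/
noncomputable def plantedU (η γ : ℝ) (win : Window) (n : Fin (win.N + 1)) : ℂ :=
  ∫ x in (-win.a)..win.a, ((xiEven (2 * win.a) (n : ℕ) x : ℝ) : ℂ) * Complex.exp ((⟨η, γ⟩ : ℂ) * (x : ℂ))

/-- `p = Re u(z)` at window `win`. [folklore] -/
noncomputable def plantedRe (η γ : ℝ) (win : Window) : Fin (win.N + 1) → ℝ := fun n => (plantedU η γ win n).re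

/-- `q = Im u(z)` at window `win`. [folklore] -/
noncomputable def plantedIm (η γ : ℝ) (win : Window) : Fin (win.N + 1) → ℝ := fun n => (plantedU η γ win n).im

/-- THE PLANTED DATUM: ζ's even blocks plus `c (p pᵀ − q qᵀ)` at every window — the explicit-formula side of ζ with
the quadruple `{½ ± η ± iγ}` planted with multiplicity `w = c/4` (`γ > 0`), resp. the real pair `{½ ± η}` with
multiplicity `w = c/2` (`γ = 0`, where `q = 0`). FAKES §2.0 (ii); weilfam `orbit_lowrank`. [folklore] -/
noncomputable def plantedDatum (c η γ : ℝ) : Datum := fun win =>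
  zetaDatum win + c • (vecMulVec (plantedRe η γ win) (plantedRe η γ win)
    - vecMulVec (plantedIm η γ win) (plantedIm η γ win))

/-- THE ENVELOPE HYPOTHESIS on `W`: `c (‖p_win‖² + ‖q_win‖²) ≤ B` at every window of `W` (analytic half of P2-ENV:
`Σ_{n ≤ N} |u_n(η+iγ)|² ≤ (4 e^{2ηa}/(Lγ²)) Σ (1 − ω_n²/γ²)^{-2}` for `πN/a < γ`; THEOREM-informal, constants DATA,
FAKES §2.1 — typed here, like `GalerkinInfZero`). [folklore] -/
def PlantedEnvelopeOn (W : Set Window) (B c η γ : ℝ) : Prop :=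
  ∀ win ∈ W, c * (plantedRe η γ win ⬝ᵥ plantedRe η γ win + plantedIm η γ win ⬝ᵥ plantedIm η γ win) ≤ B

/-- the planted perturbation is exactly `c (p pᵀ − q qᵀ)` at every window. -/
theorem plantedDatum_sub_zetaDatum (c η γ : ℝ) (win : Window) :
    plantedDatum c η γ win - zetaDatum win
      = c • (vecMulVec (plantedRe η γ win) (plantedRe η γ win) - vecMulVec (plantedIm η γ win) (plantedIm η γ win)) := by
  simp [plantedDatum]

/-- PROVED (envelope ⇒ closeness): under the envelope on `W` the planted datum is `B`-close to ζ's on `W`. -/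
theorem plantedDatum_uniformlyCloseOn {W : Set Window} {B c η γ : ℝ} (hc : 0 ≤ c)
    (hB : PlantedEnvelopeOn W B c η γ) : UniformlyCloseOn W B (plantedDatum c η γ) zetaDatum := by
  intro win hwin v
  rw [plantedDatum_sub_zetaDatum]
  have h1 := abs_dotProduct_planted_mulVec_le (plantedRe η γ win) (plantedIm η γ win) v hc
  have h2 := hB win hwin
  have h3 := dot_self_nonneg v
  calc |v ⬝ᵥ ((c • (vecMulVec (plantedRe η γ win) (plantedRe η γ win)
          - vecMulVec (plantedIm η γ win) (plantedIm η γ win))) *ᵥ v)|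
        ≤ c * (plantedRe η γ win ⬝ᵥ plantedRe η γ win + plantedIm η γ win ⬝ᵥ plantedIm η γ win) * (v ⬝ᵥ v) := h1
    _ ≤ B * (v ⬝ᵥ v) := mul_le_mul_of_nonneg_right h2 h3

/-- PROVED (adj-3's kernel target, general window set): a criterion robust on `W` at the envelope resolution that
accepts ζ accepts the planted twin. -/
theorem robustOn_accepts_planted {W : Set Window} {B c η γ : ℝ} {S : Set Datum} (hS : RobustOn W B S zetaDatum)
    (hc : 0 ≤ c) (hB : PlantedEnvelopeOn W B c η γ) (hζ : zetaDatum ∈ S) : plantedDatum c η γ ∈ S :=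
  hS.accepts (plantedDatum_uniformlyCloseOn hc hB) hζ

/-- PROVED: adj-3 RULING A29(d)(iii) verbatim (`W = rankBelow N₀`). -/
theorem robustBelow_accepts_planted {N₀ : ℕ} {B c η γ : ℝ} {S : Set Datum} (hS : RobustBelow N₀ B S zetaDatum)
    (hc : 0 ≤ c) (hB : PlantedEnvelopeOn (rankBelow N₀) B c η γ) (hζ : zetaDatum ∈ S) :
    plantedDatum c η γ ∈ S :=
  robustOn_accepts_planted ((robustBelow_iff_robustOn N₀ B S zetaDatum).mp hS) hc hB hζ

/-- PROVED: the served-box form the DATA supports (`W = served A₀ N₀`). -/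
theorem robustOnServed_accepts_planted {A₀ : ℝ} {N₀ : ℕ} {B c η γ : ℝ} {S : Set Datum}
    (hS : RobustOn (served A₀ N₀) B S zetaDatum) (hc : 0 ≤ c) (hB : PlantedEnvelopeOn (served A₀ N₀) B c η γ)
    (hζ : zetaDatum ∈ S) : plantedDatum c η γ ∈ S :=
  robustOn_accepts_planted hS hc hB hζ

/-- PROVED (what closes candidates, A29(d)(iii)): with the twin detectably negative (Arb certificate of record per
instance), NO criterion robust on `W` at resolution `B` separates a set containing the twin from ζ. -/
theorem not_separates_planted {W : Set Window} {B c η γ : ℝ} {S D : Set Datum} (hS : RobustOn W B S zetaDatum)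
    (hc : 0 ≤ c) (hB : PlantedEnvelopeOn W B c η γ) (hneg : DetectablyNegative (plantedDatum c η γ))
    (hD : plantedDatum c η γ ∈ D) : ¬ Separates S D zetaDatum :=
  hS.not_separates hD hneg (plantedDatum_uniformlyCloseOn hc hB)

/-- PROVED (the GAP-CLASS reading, A29(d)(v)): a criterion that accepts ζ and rejects the twin is not robust on `W`
at resolution `B` — it must read the served windows finer than the envelope, or read outside them. -/
theorem rejects_planted_not_robustOn {W : Set Window} {B c η γ : ℝ} {S : Set Datum} (hζ : zetaDatum ∈ S)
    (hrej : plantedDatum c η γ ∉ S) (hc : 0 ≤ c) (hB : PlantedEnvelopeOn W B c η γ) : ¬ RobustOn W B S zetaDatum :=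
  not_robustOn_of_rejects hζ hrej (plantedDatum_uniformlyCloseOn hc hB)

end Summit.RiemannHypothesis.RiemannHypothesis.Theorems.PfPersistenceF2RobustBelow

#print axioms Summit.RiemannHypothesis.RiemannHypothesis.Theorems.PfPersistenceF2RobustBelow.robustBelow_accepts_planted
#print axioms Summit.RiemannHypothesis.RiemannHypothesis.Theorems.PfPersistenceF2RobustBelow.not_separates_planted
#print axioms Summit.RiemannHypothesis.RiemannHypothesis.Theorems.PfPersistenceF2RobustBelow.robustOn_floorCriterion_of_margin
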